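import Literature.NumberTheory.EllipticCurves.WeberGamma2LevelNineRational
import HarnessLib

/-!
# The cusp form `Δ₃ = (η(τ)η(3τ))⁶ ∈ S₆(Γ₀(9))` and the level-`3` Hauptmodul
# `t = (η(τ)/η(3τ))¹² = Δ₃²/Δ(3τ) ∈ ℚ(X₀(9))`

Topic `NumberTheory/EllipticCurves`, namespace `Literature.NumberTheory.EllipticCurves.ModularForms`.
Definitions with bodies and theorems, all proved, no named fact.  Companion of
`EtaOcticLevelNine.lean` (`η(3τ)⁸ ∈ S₄(Γ₀(9))`) and `WeberGamma2LevelNine(Rational).lean`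
(`γ₂(3τ) ∈ ℚ(X₀(9))`), built the same way from the multiplier system of `η²`
(`ModularCurveEtaProductsProofs.etaSq_slash_tpD_slash`):

* `etaSexticThreeNine τ = η(τ)⁶η(3τ)⁶` is `Γ₀(9)`-invariant in weight `6`
  (`etaSexticThreeNine_slash_of_mem`): `η(τ)²η(3τ)²` picks up `e^{πi(e₁+e₃)/6}` under
  `γ = (p q; 9k s)` and **`4 ∣ e₁ + e₃`** (`four_dvd_etaSexticThreeNine_exp`, a finite check modulo `4`),
  so the cube picks up `e^{πi(e₁+e₃)/2} = 1`; with holomorphy and vanishing at all cusps this is the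
  cusp form `cuspFormEtaSexticThreeNine ∈ S₆(Γ₀(9))` (classically the newform `(η(τ)η(3τ))⁶` of
  level `3`);
* its `q`-expansion starts `q + O(q²)` (`qExpansion_etaSexticThreeNine_coeff_one`, from the product
  `η(z)⁶η(3z)⁶ = q∏(1 − qⁿ)⁶(1 − q³ⁿ)⁶`);
* **`t = (η(τ)η(3τ))¹²/Δ(3τ) ∈ K_9 = ℂ(X₀(9))`** (`tNineFn`), with value
  `tNineValue τ = (η(τ)/η(3τ))¹²` at every `τ ∈ ℍ` (`pointValuation_tNineFn_sub_lt_one`), and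
  **`t ∈ ℚ(X₀(9))`**: its `q`-series is fixed by every ring endomorphism of `ℂ`
  (`mapLaurent_tNineFn`) — since `t² = Δ(τ)/Δ(3τ)` has `σ`-fixed `q`-series, `σ(t) = ±t`, and the sign
  is `+` by the coefficient `1` of `q²` in `t·Δ(3τ) = (η(τ)η(3τ))¹²`.

These feed the level-`3` treatment of the singular moduli at conductor `3`
(`SingularModuliSquareAwayFromThree.lean`).

## References

* D. A. Cox, *Primes of the form x² + ny²*, 2nd ed. (2013), §11.B–C and §12.A (modular functions
  for `Γ₀(N)`, rationality of `q`-expansions). [Cox2013]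
* F. Diamond, J. Shurman, *A First Course in Modular Forms* (2005), §1.2 and §3.2 (`η`-quotients).
  [DiamondShurman2005]
-/

noncomputable section

open UpperHalfPlane hiding I
open Complex ModularForm CongruenceSubgroup EisensteinSeries PowerSeries Filter Topology
open scoped MatrixGroups Real ModularForm Manifold

namespace Literature.NumberTheory.EllipticCurves.ModularForms

/-! ### The multiplier exponent: `4 ∣ e₁ + e₃` on `Γ₀(9)` -/

/-- The exponent identity for `η(τ)²η(3τ)²` under `Γ₀(9)`, modulo `4` (`decide`). [folklore] -/
theorem etaSexticThreeNine_exp_mod_four : ∀ p q k s : ZMod 4, p * s - q * (9 * k) = 1 →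
    ((1 - (9 * k) ^ 2) * ((1 * q) * s + 3 * ((9 * k) - 1) * s + (9 * k) + 3) +
        (9 * k) * (p + s - 3)) +
      ((1 - (3 * k) ^ 2) * ((3 * q) * s + 3 * ((3 * k) - 1) * s + (3 * k) + 3) +
        (3 * k) * (p + s - 3)) = 0 := by
  decide

/-- **`e(γ_1) + e(γ_3) ≡ 0 (mod 4)` for `γ = (p q; 9k s) ∈ Γ₀(9)`**: the multipliers of `η(τ)⁶` and
`η(3τ)⁶` cancel. [folklore] -/
theorem four_dvd_etaSexticThreeNine_exp {p q k s : ℤ} (h : p * s - q * (9 * k) = 1) :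
    (4 : ℤ) ∣ etaSqExp p (1 * q) (9 * k) s + etaSqExp p (3 * q) (3 * k) s := by
  have hz : ((etaSqExp p (1 * q) (9 * k) s + etaSqExp p (3 * q) (3 * k) s : ℤ) : ZMod 4) = 0 := by
    have := etaSexticThreeNine_exp_mod_four p q k s
      (by exact_mod_cast congrArg (Int.cast : ℤ → ZMod 4) h)
    simp only [etaSqExp]
    push_cast
    linear_combination this
  exact_mod_cast (ZMod.intCast_zmod_eq_zero_iff_dvd _ 4).mp hz

/-! ### `Δ₃ = η(τ)⁶η(3τ)⁶` is a cusp form of weight `6` for `Γ₀(9)` -/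

/-- `ψ(τ) = η(τ)²η(3τ)²`, realised as `(η²|₁D₁)(η²|₁D₃)` (weight `2`, nontrivial multiplier). [folklore] -/
def etaSqThreePair : ℍ → ℂ :=
  (etaSq ∣[(1 : ℤ)] tpD 1) * (etaSq ∣[(1 : ℤ)] tpD 3)

/-- `ψ(τ) = η(τ)²η(3τ)²`. [folklore] -/
theorem etaSqThreePair_apply (τ : ℍ) : etaSqThreePair τ = η (τ : ℂ) ^ 2 * η (3 * (τ : ℂ)) ^ 2 := by
  rw [etaSqThreePair, Pi.mul_apply]
  simp only [etaSq_slash_tpD_apply]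
  push_cast
  ring_nf

/-- **`Δ₃(τ) = η(τ)⁶η(3τ)⁶`**, realised as `ψ³`. [folklore] -/
def etaSexticThreeNine : ℍ → ℂ :=
  etaSqThreePair * etaSqThreePair * etaSqThreePair

/-- `Δ₃(τ) = η(τ)⁶η(3τ)⁶`. [folklore] -/
theorem etaSexticThreeNine_apply (τ : ℍ) :
    etaSexticThreeNine τ = η (τ : ℂ) ^ 6 * η (3 * (τ : ℂ)) ^ 6 := by
  simp only [etaSexticThreeNine, Pi.mul_apply, etaSqThreePair_apply]
  ring

/-- `η(3τ) ≠ 0`. [folklore] -/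
theorem eta_three_mul_ne_zero (τ : ℍ) : η (3 * (τ : ℂ)) ≠ 0 :=
  ModularForm.eta_ne_zero (by simpa using mul_pos (by norm_num : (0 : ℝ) < 3) τ.2)

/-- `Δ₃(τ) ≠ 0` on `ℍ`. [folklore] -/
theorem etaSexticThreeNine_ne_zero (τ : ℍ) : etaSexticThreeNine τ ≠ 0 := by
  rw [etaSexticThreeNine_apply]
  exact mul_ne_zero (pow_ne_zero _ (ModularForm.eta_ne_zero τ.2)) (pow_ne_zero _ (eta_three_mul_ne_zero τ))

/-- `ψ|₂γ = e^{πi(e₁+e₃)/6} ψ` for `γ = (p q; 9k s) ∈ Γ₀(9)`. [folklore] -/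
theorem etaSqThreePair_slash {γ : SL(2, ℤ)} {k : ℤ} (hk : γ 1 0 = 9 * k) :
    etaSqThreePair ∣[(2 : ℤ)] (γ : GL (Fin 2) ℝ) =
      cexp (π * I / 6 * (etaSqExp (γ 0 0) (1 * γ 0 1) (9 * k) (γ 1 1) +
        etaSqExp (γ 0 0) (3 * γ 0 1) (3 * k) (γ 1 1))) • etaSqThreePair := by
  have hA : γ 1 0 = ((1 : ℕ) : ℤ) * (9 * k) := by rw [hk]; push_cast; ring
  have hB : γ 1 0 = ((3 : ℕ) : ℤ) * (3 * k) := by rw [hk]; push_cast; ring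
  have hmul := mul_slash_SL2 1 1 γ (etaSq ∣[(1 : ℤ)] tpD 1) (etaSq ∣[(1 : ℤ)] tpD 3)
  rw [show (1 : ℤ) + 1 = 2 by norm_num] at hmul
  rw [etaSqThreePair, ← SL_slash, hmul, SL_slash (f := etaSq ∣[(1 : ℤ)] tpD 1),
    SL_slash (f := etaSq ∣[(1 : ℤ)] tpD 3), etaSq_slash_tpD_slash 1 hA,
    etaSq_slash_tpD_slash 3 hB, smul_mul_smul_comm, ← Complex.exp_add, ← mul_add]
  simp only [Nat.cast_ofNat, Nat.cast_one]

/-- **`Δ₃ = η(τ)⁶η(3τ)⁶` is `Γ₀(9)`-invariant in weight `6`**: `ψ³` picks up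
`e^{πi(e₁+e₃)/2} = 1` since `4 ∣ e₁ + e₃`. [folklore] -/
theorem etaSexticThreeNine_slash_of_mem {γ : SL(2, ℤ)} (hγ : γ ∈ Gamma0 9) :
    etaSexticThreeNine ∣[(6 : ℤ)] γ = etaSexticThreeNine := by
  rw [Gamma0_mem] at hγ
  obtain ⟨k, hk⟩ := (ZMod.intCast_zmod_eq_zero_iff_dvd _ 9).mp hγ
  have hdet : γ 0 0 * γ 1 1 - γ 0 1 * γ 1 0 = 1 := by
    have := Matrix.det_fin_two (γ : Matrix (Fin 2) (Fin 2) ℤ)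
    rw [γ.det_coe] at this
    linarith
  set f := etaSqThreePair with hf
  set c : ℂ := cexp (π * I / 6 * (etaSqExp (γ 0 0) (1 * γ 0 1) (9 * k) (γ 1 1) +
    etaSqExp (γ 0 0) (3 * γ 0 1) (3 * k) (γ 1 1))) with hcdef
  have h1 : f ∣[(2 : ℤ)] (γ : GL (Fin 2) ℝ) = c • f := etaSqThreePair_slash hk
  have hc3 : c ^ 3 = 1 := by
    obtain ⟨m, hm⟩ := four_dvd_etaSexticThreeNine_exp (p := γ 0 0) (q := γ 0 1) (k := k) (s := γ 1 1)
      (by have h' := hdet; rw [hk] at h'; push_cast at h'; linarith)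
    rw [hcdef, ← Complex.exp_nat_mul]
    have hm' : ((etaSqExp (γ 0 0) (1 * γ 0 1) (9 * k) (γ 1 1) : ℂ)) +
        (etaSqExp (γ 0 0) (3 * γ 0 1) (3 * k) (γ 1 1) : ℂ) = 4 * m := by exact_mod_cast hm
    rw [hm', show ((3 : ℕ) : ℂ) * (π * I / 6 * (4 * (m : ℂ))) = m * (2 * π * I) by push_cast; ring]
    exact Complex.exp_int_mul_two_pi_mul_I m
  have h2 := ModularForm.mul_slash_SL2 2 2 γ f f
  have h3 := ModularForm.mul_slash_SL2 4 2 γ (f * f) f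
  rw [show (2 : ℤ) + 2 = 4 by norm_num] at h2
  rw [show (4 : ℤ) + 2 = 6 by norm_num] at h3
  rw [etaSexticThreeNine, ← hf, h3, h2, ModularForm.SL_slash, h1]
  ext τ
  simp only [Pi.mul_apply, Pi.smul_apply, smul_eq_mul]
  have : c * f τ * (c * f τ) * (c * f τ) = c ^ 3 * (f τ * f τ * f τ) := by ring
  rw [this, hc3, one_mul]

/-- `Δ₃` is holomorphic on `ℍ`. [folklore] -/
theorem mdifferentiable_etaSexticThreeNine : MDifferentiable 𝓘(ℂ) 𝓘(ℂ) etaSexticThreeNine := by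
  have hψ : MDifferentiable 𝓘(ℂ) 𝓘(ℂ) etaSqThreePair :=
    (mdifferentiable_etaSq.slash _ _).mul (mdifferentiable_etaSq.slash _ _)
  exact (hψ.mul hψ).mul hψ

/-- All `SL₂(ℤ)`-translates of `Δ₃` vanish at `i∞`. [folklore] -/
theorem isZeroAtImInfty_etaSexticThreeNine_slash (γ : SL(2, ℤ)) :
    IsZeroAtImInfty (etaSexticThreeNine ∣[(6 : ℤ)] (γ : GL (Fin 2) ℝ)) := by
  set f := etaSqThreePair with hf
  have hψ : IsZeroAtImInfty (f ∣[(2 : ℤ)] (γ : GL (Fin 2) ℝ)) := by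
    have hmul := mul_slash_SL2 1 1 γ (etaSq ∣[(1 : ℤ)] tpD 1) (etaSq ∣[(1 : ℤ)] tpD 3)
    rw [show (1 : ℤ) + 1 = 2 by norm_num, SL_slash, SL_slash, SL_slash] at hmul
    rw [hf, etaSqThreePair, hmul]
    have h := (isZeroAtImInfty_etaSq_slash_tpD_slash 1 γ).mul
      (isZeroAtImInfty_etaSq_slash_tpD_slash 3 γ)
    simp only [mul_zero] at h
    exact h
  have h2 := ModularForm.mul_slash_SL2 2 2 γ f f
  have h3 := ModularForm.mul_slash_SL2 4 2 γ (f * f) f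
  rw [show (2 : ℤ) + 2 = 4 by norm_num] at h2
  rw [show (4 : ℤ) + 2 = 6 by norm_num] at h3
  simp only [ModularForm.SL_slash] at h2 h3
  rw [etaSexticThreeNine, ← hf, h3, h2]
  have h := (hψ.mul hψ).mul hψ
  simp only [mul_zero] at h
  exact h

/-- **The cusp form `Δ₃ = (η(τ)η(3τ))⁶ ∈ S₆(Γ₀(9))`** (classically the newform of level `3` and
weight `6`; membership proved from the multiplier of `η²`). [folklore] -/
def cuspFormEtaSexticThreeNine : CuspForm (Gamma0 9) 6 where
  toFun := etaSexticThreeNine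
  slash_action_eq' A hA := by
    obtain ⟨γ, hγ, rfl⟩ := hA
    exact etaSexticThreeNine_slash_of_mem hγ
  holo' := mdifferentiable_etaSexticThreeNine
  zero_at_cusps' hc := by
    rw [Subgroup.IsArithmetic.isCusp_iff_isCusp_SL2Z] at hc
    rw [OnePoint.isZeroAt_iff_forall_SL2Z hc]
    intro γ _
    exact isZeroAtImInfty_etaSexticThreeNine_slash γ

/-- The underlying function of `cuspFormEtaSexticThreeNine`. [folklore] -/
@[simp] theorem coe_cuspFormEtaSexticThreeNine :
    (cuspFormEtaSexticThreeNine : ℍ → ℂ) = etaSexticThreeNine := rfl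

/-- `Δ₃` as a modular form of weight `6` for `Γ₀(9)`. [folklore] -/
def etaSexticThreeNineForm : ModularForm (Gamma0 9) 6 :=
  ModularFormClass.modularForm cuspFormEtaSexticThreeNine

/-- The underlying function of `etaSexticThreeNineForm`. [folklore] -/
theorem coe_etaSexticThreeNineForm : (⇑etaSexticThreeNineForm : ℍ → ℂ) = etaSexticThreeNine := rfl

/-- `etaSexticThreeNineForm τ = η(τ)⁶η(3τ)⁶`. [folklore] -/
@[simp] theorem etaSexticThreeNineForm_apply (τ : ℍ) :
    etaSexticThreeNineForm τ = η (τ : ℂ) ^ 6 * η (3 * (τ : ℂ)) ^ 6 := by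
  rw [← etaSexticThreeNine_apply]; rfl

/-! ### The `q`-expansion of `Δ₃` starts `q + O(q²)` -/

/-- **`η(z)⁶η(3z)⁶ = q ∏ (1 − q^{n+1})⁶ ∏ (1 − q^{3(n+1)})⁶`**, `q = e^{2πiz}`. [folklore] -/
theorem etaSexticThreeNine_eq_q_prod (z : ℍ) :
    etaSexticThreeNine z = Function.Periodic.qParam 1 z *
      ((∏' n : ℕ, (1 - (Function.Periodic.qParam 1 z) ^ (n + 1)) ^ 6) *
        ∏' n : ℕ, (1 - (Function.Periodic.qParam 1 z) ^ (3 * (n + 1))) ^ 6) := by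
  have hz1 : (z : ℂ) ∈ upperHalfPlaneSet := z.2
  have hz3 : (3 * (z : ℂ)) ∈ upperHalfPlaneSet := by
    simpa using mul_pos (by norm_num : (0 : ℝ) < 3) z.2
  have hq24 : (Function.Periodic.qParam 24 (z : ℂ)) ^ 6 * (Function.Periodic.qParam 24 (3 * (z : ℂ))) ^ 6 =
      Function.Periodic.qParam 1 z := by
    simp only [Function.Periodic.qParam]
    rw [← Complex.exp_nat_mul, ← Complex.exp_nat_mul, ← Complex.exp_add]
    congr 1
    push_cast
    ring
  have hq3 : ∀ n : ℕ, eta_q n (3 * (z : ℂ)) = (Function.Periodic.qParam 1 z) ^ (3 * (n + 1)) := by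
    intro n
    simp only [eta_q, Function.Periodic.qParam]
    rw [← Complex.exp_nat_mul, ← Complex.exp_nat_mul]
    congr 1
    push_cast
    ring
  have hmult1 : Multipliable fun n : ℕ ↦ 1 - eta_q n (z : ℂ) :=
    multipliableLocallyUniformlyOn_eta.multipliable hz1
  have hmult3 : Multipliable fun n : ℕ ↦ 1 - eta_q n (3 * (z : ℂ)) :=
    multipliableLocallyUniformlyOn_eta.multipliable hz3
  have hP1 : (∏' n : ℕ, (1 - eta_q n (z : ℂ)) ^ 6) =
      ∏' n : ℕ, (1 - (Function.Periodic.qParam 1 z) ^ (n + 1)) ^ 6 := rfl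
  have hP3 : (∏' n : ℕ, (1 - eta_q n (3 * (z : ℂ))) ^ 6) =
      ∏' n : ℕ, (1 - (Function.Periodic.qParam 1 z) ^ (3 * (n + 1))) ^ 6 :=
    tprod_congr fun n ↦ by rw [hq3]
  rw [etaSexticThreeNine_apply, ModularForm.eta, ModularForm.eta, mul_pow, mul_pow,
    ← Multipliable.tprod_pow hmult1, ← Multipliable.tprod_pow hmult3, hP1, hP3, ← hq24]
  ring

/-- `Δ₃ → 0` at `i∞`. [folklore] -/
theorem isZeroAtImInfty_etaSexticThreeNine : IsZeroAtImInfty etaSexticThreeNine := by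
  have h := isZeroAtImInfty_etaSexticThreeNine_slash 1
  simpa using h

/-- The cusp function of `Δ₃` on the unit disc is `q ∏(1 − q^{i+1})⁶ ∏(1 − q^{3(i+1)})⁶`. [folklore] -/
theorem etaSexticThreeNine_cuspFunction_eqOn : Set.EqOn (cuspFunction 1 etaSexticThreeNine)
    (fun q ↦ q * ((∏' i : ℕ, (1 - q ^ (i + 1)) ^ 6) * ∏' i : ℕ, (1 - q ^ (3 * (i + 1))) ^ 6))
      (Metric.ball 0 1) := by
  intro q hq
  by_cases hq0 : q = 0
  · simpa [hq0] using! Function.Periodic.cuspFunction_zero_of_zero_at_inf one_pos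
      isZeroAtImInfty_etaSexticThreeNine.zero_at_infty_comp_ofComplex
  · have him := Function.Periodic.im_invQParam_pos_of_norm_lt_one one_pos
      (by simpa [dist_zero_right] using hq) hq0
    simp [cuspFunction, Function.Periodic.cuspFunction_eq_of_nonzero 1 _ hq0,
      ofComplex_apply_of_im_pos him, etaSexticThreeNine_eq_q_prod ⟨_, him⟩,
      Function.Periodic.qParam_right_inv one_ne_zero hq0]

/-- The product factor is differentiable on the unit disc. [folklore] -/
theorem differentiableOn_etaSextic_prod :
    DifferentiableOn ℂ (fun q : ℂ ↦ (∏' i : ℕ, (1 - q ^ (i + 1)) ^ 6) *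
      ∏' i : ℕ, (1 - q ^ (3 * (i + 1))) ^ 6) (Metric.ball 0 1) := by
  have h6 := differentiableOn_tprod_one_sub_pow_pow 6
  have hcomp : (fun q : ℂ ↦ ∏' i : ℕ, (1 - q ^ (3 * (i + 1))) ^ 6) =
      (fun q : ℂ ↦ ∏' i : ℕ, (1 - q ^ (i + 1)) ^ 6) ∘ (fun q : ℂ ↦ q ^ 3) := by
    funext q
    simp only [Function.comp_apply, ← pow_mul]
  refine h6.mul ?_
  rw [hcomp]
  refine h6.comp (differentiableOn_pow 3) fun q hq ↦ ?_
  simp only [Metric.mem_ball, dist_zero_right, norm_pow] at hq ⊢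
  calc ‖q‖ ^ 3 < 1 ^ 3 := by gcongr
    _ = 1 := one_pow 3

/-- **The first `q`-coefficient of `Δ₃ = η(τ)⁶η(3τ)⁶` is `1`** (`Δ₃ = q − 6q² + …`). [folklore] -/
theorem qExpansion_etaSexticThreeNine_coeff_one : (qExpansion 1 etaSexticThreeNine).coeff 1 = 1 := by
  have hmem : (0 : ℂ) ∈ Metric.ball (0 : ℂ) 1 := Metric.mem_ball_self one_pos
  calc (qExpansion 1 etaSexticThreeNine).coeff 1
      = derivWithin (cuspFunction 1 etaSexticThreeNine) (Metric.ball 0 1) 0 := by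
        simp [qExpansion_coeff, ← derivWithin_of_isOpen Metric.isOpen_ball hmem]
    _ = derivWithin (fun q ↦ q * ((∏' i : ℕ, (1 - q ^ (i + 1)) ^ 6) *
          ∏' i : ℕ, (1 - q ^ (3 * (i + 1))) ^ 6)) (Metric.ball 0 1) 0 :=
        derivWithin_congr etaSexticThreeNine_cuspFunction_eqOn (etaSexticThreeNine_cuspFunction_eqOn hmem)
    _ = 1 := by
        rw [derivWithin_fun_mul differentiableWithinAt_fun_id (differentiableOn_etaSextic_prod _ hmem),
          derivWithin_id' _ _ (Metric.isOpen_ball.uniqueDiffWithinAt hmem)]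
        simp

/-- **The constant `q`-coefficient of `Δ₃` is `0`** (a cusp form). [folklore] -/
theorem qExpansion_etaSexticThreeNine_coeff_zero : (qExpansion 1 etaSexticThreeNine).coeff 0 = 0 := by
  have hmem : (0 : ℂ) ∈ Metric.ball (0 : ℂ) 1 := Metric.mem_ball_self one_pos
  rw [qExpansion_coeff]
  simp only [Nat.factorial_zero, Nat.cast_one, inv_one, iteratedDeriv_zero, one_mul]
  rw [etaSexticThreeNine_cuspFunction_eqOn hmem]
  simp

/-! ### `t = Δ₃²/Δ(3τ) = (η(τ)/η(3τ))¹² ∈ K_9` and its values -/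

/-- `Δ₃² = (η(τ)η(3τ))¹²` as a modular form of weight `12` for `Γ₀(9)`. [folklore] -/
def etaTwelfthThreeNine : ModularForm (Gamma0 9) 12 :=
  (etaSexticThreeNineForm.mul etaSexticThreeNineForm).mcast (by norm_num)

/-- The underlying function of `etaTwelfthThreeNine`. [folklore] -/
theorem coe_etaTwelfthThreeNine :
    (⇑etaTwelfthThreeNine : ℍ → ℂ) = ⇑etaSexticThreeNineForm * ⇑etaSexticThreeNineForm := rfl

/-- `etaTwelfthThreeNine τ = η(τ)¹²η(3τ)¹²`. [folklore] -/
theorem etaTwelfthThreeNine_apply (τ : ℍ) :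
    etaTwelfthThreeNine τ = η (τ : ℂ) ^ 12 * η (3 * (τ : ℂ)) ^ 12 := by
  rw [show (etaTwelfthThreeNine τ : ℂ) = etaSexticThreeNineForm τ * etaSexticThreeNineForm τ from rfl,
    etaSexticThreeNineForm_apply]
  ring

/-- **The value `t(τ) = (η(τ)/η(3τ))¹²`** of the level-`3` Hauptmodul. [folklore] -/
def tNineValue (τ : ℍ) : ℂ := (η (τ : ℂ) / η (3 * (τ : ℂ))) ^ 12

/-- `t(τ) ≠ 0`. [folklore] -/
theorem tNineValue_ne_zero (τ : ℍ) : tNineValue τ ≠ 0 :=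
  pow_ne_zero _ (div_ne_zero (ModularForm.eta_ne_zero τ.2) (eta_three_mul_ne_zero τ))

/-- `(η(τ)η(3τ))¹² = t(τ) · Δ(3τ)`. [folklore] -/
theorem etaTwelfthThreeNine_apply_eq (τ : ℍ) :
    etaTwelfthThreeNine τ = tNineValue τ * deltaThreeNine τ := by
  have hη := eta_three_mul_ne_zero τ
  rw [etaTwelfthThreeNine_apply, tNineValue, deltaThreeNine_apply_eq_eta_pow]
  field_simp

/-- **`t = (η(τ)η(3τ))¹²/Δ(3τ)` as an element of `K_9 = ℂ(X₀(9))`.** [cite: Cox2013, §11.C] -/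
def tNineFn : modularFunctionField 9 :=
  mkFn etaTwelfthThreeNine deltaThreeNine deltaThreeNine_ne_zero

/-- **The value of `t ∈ K_9` at `τ` is `(η(τ)/η(3τ))¹²`**: `v_τ(t − t(τ)) < 1`. [folklore] -/
theorem pointValuation_tNineFn_sub_lt_one (τ : ℍ) :
    pointValuation (N := 9) τ (tNineFn - algebraMap ℂ (modularFunctionField 9) (tNineValue τ)) < 1 := by
  apply pointValuation_mkFn_sub_lt_one_of_orderAt_lt
  set c : ℂ := tNineValue τ with hc
  set G : ModularForm (Gamma0 9) 12 := etaTwelfthThreeNine - c • deltaThreeNine with hG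
  by_cases hG0 : G = 0
  · exact Or.inl hG0
  · right
    have hGτ : G τ = 0 := by
      have h1 : G τ = etaTwelfthThreeNine τ - c * deltaThreeNine τ := by
        simp [hG, sub_eq_add_neg]
      rw [h1, etaTwelfthThreeNine_apply_eq, hc, sub_self]
    rw [(orderAt_eq_zero_iff deltaThreeNine_ne_zero τ).mpr (deltaThreeNine_apply_ne_zero τ)]
    exact Nat.pos_of_ne_zero fun h0 ↦ (orderAt_eq_zero_iff hG0 τ).mp h0 hGτ

/-! ### `t ∈ ℚ(X₀(9))` -/

variable (σ : ℂ →+* ℂ)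

/-- `(η(τ)η(3τ))²⁴ = Δ(τ)Δ(3τ)`: `Δ₃² · Δ₃² = Δ|_{Γ₀(9)} · Δ(3τ)` as forms of weight `24`. [folklore] -/
theorem etaTwelfthThreeNine_mul_self :
    etaTwelfthThreeNine.mul etaTwelfthThreeNine = (deltaN 9).mul deltaThreeNine := by
  apply DFunLike.ext
  intro τ
  change etaTwelfthThreeNine τ * etaTwelfthThreeNine τ = deltaN 9 τ * deltaThreeNine τ
  rw [etaTwelfthThreeNine_apply, deltaThreeNine_apply_eq_eta_pow]
  simp only [deltaN, coe_ofLevelOne, delta_apply, ModularForm.discriminant]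
  ring

/-- `t² = Δ(τ)/Δ(3τ)` in `ℂ((q))`. [folklore] -/
theorem tNineFn_sq :
    ((tNineFn : modularFunctionField 9) : LaurentSeries ℂ) ^ 2 =
      qExpansionL 9 (deltaN 9) / qExpansionL 9 deltaThreeNine := by
  have hΔ : qExpansionL 9 deltaThreeNine ≠ 0 := (qExpansionL_eq_zero_iff 9 _).not.mpr deltaThreeNine_ne_zero
  have hrepr : ((tNineFn : modularFunctionField 9) : LaurentSeries ℂ) * qExpansionL 9 deltaThreeNine =
      qExpansionL 9 etaTwelfthThreeNine := mkFn_mul _ _ _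
  have hsq : qExpansionL 9 etaTwelfthThreeNine * qExpansionL 9 etaTwelfthThreeNine =
      qExpansionL 9 (deltaN 9) * qExpansionL 9 deltaThreeNine := by
    rw [← qExpansionL_mul, etaTwelfthThreeNine_mul_self, qExpansionL_mul]
  rw [eq_div_iff hΔ]
  have h : (((tNineFn : modularFunctionField 9) : LaurentSeries ℂ) ^ 2 * qExpansionL 9 deltaThreeNine) *
      qExpansionL 9 deltaThreeNine = qExpansionL 9 (deltaN 9) * qExpansionL 9 deltaThreeNine := by
    rw [← hsq, ← hrepr]; ring
  exact mul_right_cancel₀ hΔ h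

/-- `σ` maps the `q`-series of `t` to `± t`. [folklore] -/
theorem mapLaurent_tNineFn_eq_or :
    mapLaurent σ ((tNineFn : modularFunctionField 9) : LaurentSeries ℂ) = tNineFn ∨
      mapLaurent σ ((tNineFn : modularFunctionField 9) : LaurentSeries ℂ) = -tNineFn := by
  set u : LaurentSeries ℂ := ((tNineFn : modularFunctionField 9) : LaurentSeries ℂ) with hu
  have hsq : (mapLaurent σ u) ^ 2 = u ^ 2 := by
    rw [← map_pow, hu, tNineFn_sq, map_div₀, mapLaurent_qExpansionL_eq σ (isRatQExp_deltaN (N := 9) σ),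
      mapLaurent_qExpansionL_eq σ (isRatQExp_deltaThreeNine σ)]
  exact sq_eq_sq_iff_eq_or_eq_neg.mp hsq

/-- **`(η(τ)η(3τ))¹² = q² + O(q³)`: the second `q`-coefficient of `Δ₃²` is `1`.** [folklore] -/
theorem qExpansion_etaTwelfthThreeNine_coeff_two : (qExpansion 1 ⇑etaTwelfthThreeNine).coeff 2 = 1 := by
  have hF := ModularFormClass.analyticAt_cuspFunction_zero etaSexticThreeNineForm one_pos
    (one_mem_strictPeriods_coe_gamma0 9)
  rw [coe_etaTwelfthThreeNine, UpperHalfPlane.qExpansion_mul hF hF, coe_etaSexticThreeNineForm,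
    PowerSeries.coeff_mul, Finset.Nat.sum_antidiagonal_eq_sum_range_succ_mk, Finset.sum_range_succ,
    Finset.sum_range_succ, Finset.sum_range_succ, Finset.sum_range_zero]
  have h0 := qExpansion_etaSexticThreeNine_coeff_zero
  have h1 := qExpansion_etaSexticThreeNine_coeff_one
  simp [h0, h1]

/-- **`t ∈ ℚ(X₀(9))`: the `q`-series of `t ∈ K_9` is fixed by every ring endomorphism of `ℂ`.**  The sign
in `σ(t) = ±t` is `+`: apply `σ` to `t · Δ(3τ) = (η(τ)η(3τ))¹²`, whose second `q`-coefficient is `1`.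
[cite: Cox2013, §11.C (rational `q`-expansions)] -/
theorem mapLaurent_tNineFn :
    mapLaurent σ ((tNineFn : modularFunctionField 9) : LaurentSeries ℂ) = tNineFn := by
  rcases mapLaurent_tNineFn_eq_or σ with h | h
  · exact h
  · exfalso
    set u : LaurentSeries ℂ := ((tNineFn : modularFunctionField 9) : LaurentSeries ℂ) with hu
    have hrepr : u * qExpansionL 9 deltaThreeNine = qExpansionL 9 etaTwelfthThreeNine := mkFn_mul _ _ _
    have h1 : -(qExpansionL 9 etaTwelfthThreeNine) = mapLaurent σ (qExpansionL 9 etaTwelfthThreeNine) := by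
      have h' := congrArg (mapLaurent σ) hrepr
      rw [map_mul, h, mapLaurent_qExpansionL_eq σ (isRatQExp_deltaThreeNine σ)] at h'
      rw [← h', ← hrepr]
      ring
    have h2 : -(qExpansion 1 ⇑etaTwelfthThreeNine) = (qExpansion 1 ⇑etaTwelfthThreeNine).map σ := by
      apply HahnSeries.ofPowerSeries_injective (Γ := ℤ) (R := ℂ)
      rw [← mapLaurent_coe_powerSeries, ← qExpansionL_def, ← h1, qExpansionL_def, PowerSeries.coe_neg]
    have h3 := congrArg (PowerSeries.coeff 2) h2
    rw [map_neg, PowerSeries.coeff_map, qExpansion_etaTwelfthThreeNine_coeff_two, map_one] at h3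
    norm_num at h3

end Literature.NumberTheory.EllipticCurves.ModularForms

end
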